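import Summits.KontsevichZagierPeriods.KontsevichZagierPeriods.Theses.HurwitzMicroSectors
import Summits.KontsevichZagierPeriods.KontsevichZagierPeriods.Theorems.HurwitzMicroSectorsNormalFormPrinciplePiBoxTransfer
import Summits.KontsevichZagierPeriods.KontsevichZagierPeriods.Theorems.HurwitzMicroSectorsNormalFormPrincipleVariants2349

/-! TTRL-lite variant V2243 of stmt-KontsevichZagierPeriods-3869

Variant V2243 = `stub_boxRigidity` (the leaf `BoxRigidity` of `NormalFormPrinciple`: two box-rational
representations — domain the open unit box, integrand `p/q` over `ℚ` — with equal values are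
KZ-equivalent) under the move `fix_nat:m=3; bound_nat:m'≤3` (left dimension frozen to `3`, right
dimension bounded by `3`). Verdict of the attempt seat: **open** — this file is the exact-strength
certificate, not a proof of the variant. The bound `m' ≤ 3` admits `m' = 0`, so comparing a
box-rational `N : IntegralRep 3` of value `0` with the zero representation on the `0`-box shows that
V2243 gives **BoxVanishing in dimension `3`** — every box-rational representation on `(0,1)³` of value
`0` is a relation (`boxVanishing_three_of_stub_boxRigidity_var2243`); conversely BoxVanishing(3) gives
V2243 by padding `N'` to the `3`-box with unit intervals (`pad_le`) and subtracting the integrands on the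
common box (`sub_same`; the difference has value `0` by soundness) — `boxRigidityLe_three_of_boxVanishing_three`
of the sibling certificate `…Variants2349`, reused. Hence V2243 ⟺ BoxVanishing(3)
(`stub_boxRigidity_var2243_iff_boxVanishing_three`) ⟺ BoxRigidity with both dimensions `≤ 3`
(`stub_boxRigidity_var2243_iff_boxRigidityLe_three`) ⟺ BoxVanishing in all dimensions `≤ 3`
(`stub_boxRigidity_var2243_iff_boxVanishingLe_three`): literally the same strength as the sibling
variants V2242 (`m = m' = 3`), V2239, V2349, V2350 — Conjecture 1 of Kontsevich–Zagier for all pairs of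
rational integrands on the boxes `(0,1)^{≤3}`, which contains the case split `ζ(3) ∈ ℚ + ℚπ²`
(`[1/(1−xyz)]` versus `[a + b/(1−xy)]`, `a b : ℚ`) and the level-`4` weight-`2` Catalan sector without
its open independence hypothesis `LinearIndependent ℚ ![1, π², G]` — open mathematics; the proved
two-sided instance is `m, m' ≤ 1` (`boxRigidity_of_le_one`, Baker). The bound `m' ≤ 3` is idle once
`m = 3` is fixed. The variant is implied by the Summit (`stub_boxRigidity_var2243_of_statement`), so a
refutation of V2243 would refute Conjecture 1 for the tree's calculus.
Source: M. Kontsevich, D. Zagier, *Periods* (2001), §1.2 Conjecture 1. Pure proof file, no definitions. -/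

-- `Summit.<Summit>.<Problem>` is the tree's mandated summit-side namespace (CONVENTIONS §2); for this
-- single-conjunct summit the two coincide, so the duplicate is deliberate.
set_option linter.dupNamespace false

noncomputable section

namespace Summit.KontsevichZagierPeriods.KontsevichZagierPeriods.Theorems

open MeasureTheory Set
open Literature.NumberTheory.Transcendental Literature.NumberTheory.Transcendental.KZ
open Summit.KontsevichZagierPeriods.KontsevichZagierPeriods.Theses.HurwitzMicroSectors
open Summit.KontsevichZagierPeriods.HurwitzMicroSectors.NormalFormPrinciple.PiBox
open Summit.KontsevichZagierPeriods.HurwitzMicroSectors.NormalFormPrinciple.PiBox.stub_boxCombineAux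

/-! ## V2243 ⇒ BoxVanishing in dimension 3 (the slice `m' = 0`) -/

/-- **V2243 ⇒ BoxVanishing in dimension `3`**: compare a box-rational `N : IntegralRep 3` of value `0`
with the zero representation on the `0`-box (box-rational, value `0`, itself a relation; `0 ≤ 3`).
[cite: KontsevichZagier2001, §1.2 Conjecture 1] -/
theorem boxVanishing_three_of_stub_boxRigidity_var2243
    (h : ∀ (m' : ℕ) (N : IntegralRep 3) (N' : IntegralRep m'), m' ≤ 3 → N.domain = {x | ∀ i, x i ∈ Set.Ioo (0:ℝ) 1} → N.IsRational → N'.domain = {x | ∀ i, x i ∈ Set.Ioo (0:ℝ) 1} → N'.IsRational → N.value = N'.value → Equivalent N N')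
    (N : IntegralRep 3) (hNd : N.domain = {x | ∀ i, x i ∈ Set.Ioo (0:ℝ) 1}) (hNr : N.IsRational)
    (hv : N.value = 0) : of N ∈ relations := by
  obtain ⟨Z, hZd, hZi⟩ := exists_zeroRep (isSemialgebraic_box 0)
  have hZ : of Z ∈ relations := of_mem_relations_of_eqOn_zero Z (by simp [hZi, EqOn])
  have hZv : Z.value = 0 := by simp [IntegralRep.value, hZi]
  have hZr : Z.IsRational := ⟨0, 1, fun x _ => by simp, fun x _ => by simp [hZi]⟩
  have h' : of N - of Z ∈ relations := h 0 N Z (Nat.zero_le 3) hNd hNr hZd hZr (by rw [hv, hZv])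
  simpa using relations.add_mem h' hZ

/-! ## BoxVanishing in dimension 3 ⇒ BoxRigidity with both dimensions ≤ 3 ⇒ V2243 -/

/-- **BoxVanishing in dimension `3` ⇒ V2243**: the slice `m = 3` of BoxRigidity with both dimensions
`≤ 3`, which BoxVanishing(3) gives by padding both representations to the `3`-box (`pad_le`) and
subtracting on the common box (`sub_same`) — `boxRigidityLe_three_of_boxVanishing_three`, file
`…Variants2349`.
[cite: KontsevichZagier2001, §1.2 Conjecture 1] -/
theorem stub_boxRigidity_var2243_of_boxVanishing_three
    (hvan : ∀ (M : IntegralRep 3), M.domain = {x | ∀ i, x i ∈ Set.Ioo (0:ℝ) 1} → M.IsRational →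
      M.value = 0 → of M ∈ relations) :
    ∀ (m' : ℕ) (N : IntegralRep 3) (N' : IntegralRep m'), m' ≤ 3 → N.domain = {x | ∀ i, x i ∈ Set.Ioo (0:ℝ) 1} → N.IsRational → N'.domain = {x | ∀ i, x i ∈ Set.Ioo (0:ℝ) 1} → N'.IsRational → N.value = N'.value → Equivalent N N' :=
  fun m' N N' hm' => boxRigidityLe_three_of_boxVanishing_three hvan 3 m' N N' le_rfl hm'

/-! ## The exact strength of V2243: Conjecture 1 for box-rational periods of dimension 3 -/

/-- **V2243 ⟺ BoxVanishing in dimension `3`** (every box-rational representation on `(0,1)³` of value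
`0` is a relation) — the same right-hand side as V2242/V2349/V2350/V2239, so all these variants are
literally equivalent. [cite: KontsevichZagier2001, §1.2 Conjecture 1] -/
theorem stub_boxRigidity_var2243_iff_boxVanishing_three :
    (∀ (m' : ℕ) (N : IntegralRep 3) (N' : IntegralRep m'), m' ≤ 3 → N.domain = {x | ∀ i, x i ∈ Set.Ioo (0:ℝ) 1} → N.IsRational → N'.domain = {x | ∀ i, x i ∈ Set.Ioo (0:ℝ) 1} → N'.IsRational → N.value = N'.value → Equivalent N N') ↔
    (∀ (M : IntegralRep 3), M.domain = {x | ∀ i, x i ∈ Set.Ioo (0:ℝ) 1} → M.IsRational →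
      M.value = 0 → of M ∈ relations) :=
  ⟨boxVanishing_three_of_stub_boxRigidity_var2243, stub_boxRigidity_var2243_of_boxVanishing_three⟩

/-- **V2243 ⟺ BoxRigidity with both dimensions `≤ 3`** (Conjecture 1 for all pairs of rational
integrands on the open unit boxes of dimension at most `3`; the bound `m' ≤ 3` of V2243 is idle).
[cite: KontsevichZagier2001, §1.2 Conjecture 1] -/
theorem stub_boxRigidity_var2243_iff_boxRigidityLe_three :
    (∀ (m' : ℕ) (N : IntegralRep 3) (N' : IntegralRep m'), m' ≤ 3 → N.domain = {x | ∀ i, x i ∈ Set.Ioo (0:ℝ) 1} → N.IsRational → N'.domain = {x | ∀ i, x i ∈ Set.Ioo (0:ℝ) 1} → N'.IsRational → N.value = N'.value → Equivalent N N') ↔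
    (∀ (m m' : ℕ) (N : IntegralRep m) (N' : IntegralRep m'), m ≤ 3 → m' ≤ 3 →
      N.domain = {x | ∀ i, x i ∈ Set.Ioo (0:ℝ) 1} → N.IsRational →
      N'.domain = {x | ∀ i, x i ∈ Set.Ioo (0:ℝ) 1} → N'.IsRational →
      N.value = N'.value → Equivalent N N') :=
  ⟨fun h => boxRigidityLe_three_of_boxVanishing_three (boxVanishing_three_of_stub_boxRigidity_var2243 h),
    fun h m' N N' hm' => h 3 m' N N' le_rfl hm'⟩

/-- **V2243 ⟺ BoxVanishing in ALL dimensions `≤ 3`** (so V2243 also decides the square and the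
interval: pad to the `3`-box). [cite: KontsevichZagier2001, §1.2 Conjecture 1] -/
theorem stub_boxRigidity_var2243_iff_boxVanishingLe_three :
    (∀ (m' : ℕ) (N : IntegralRep 3) (N' : IntegralRep m'), m' ≤ 3 → N.domain = {x | ∀ i, x i ∈ Set.Ioo (0:ℝ) 1} → N.IsRational → N'.domain = {x | ∀ i, x i ∈ Set.Ioo (0:ℝ) 1} → N'.IsRational → N.value = N'.value → Equivalent N N') ↔
    (∀ (m : ℕ) (M : IntegralRep m), m ≤ 3 → M.domain = {x | ∀ i, x i ∈ Set.Ioo (0:ℝ) 1} →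
      M.IsRational → M.value = 0 → of M ∈ relations) := by
  refine ⟨fun h m M hm hMd hMr hv => ?_, fun hvan =>
    stub_boxRigidity_var2243_of_boxVanishing_three fun M => hvan 3 M le_rfl⟩
  obtain ⟨R, hRd, hRr, hR⟩ := pad_le hm M hMd hMr
  have hRv : R.value = 0 := (Equivalent.value_eq_holds hR).symm.trans hv
  have := relations.add_mem hR (boxVanishing_three_of_stub_boxRigidity_var2243 h R hRd hRr hRv)
  rwa [sub_add_cancel] at this

/-! ## V2243 follows from the parent leaf and from the Summit -/

/-- **The parent leaf ⇒ V2243** (specialisation `m = 3`, the bound on `m'` dropped).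
[cite: KontsevichZagier2001, §1.2 Conjecture 1] -/
theorem stub_boxRigidity_var2243_of_parent
    (h : ∀ (m m' : ℕ) (N : IntegralRep m) (N' : IntegralRep m'), N.domain = {x | ∀ i, x i ∈ Set.Ioo (0:ℝ) 1} → N.IsRational → N'.domain = {x | ∀ i, x i ∈ Set.Ioo (0:ℝ) 1} → N'.IsRational → N.value = N'.value → Equivalent N N') :
    ∀ (m' : ℕ) (N : IntegralRep 3) (N' : IntegralRep m'), m' ≤ 3 → N.domain = {x | ∀ i, x i ∈ Set.Ioo (0:ℝ) 1} → N.IsRational → N'.domain = {x | ∀ i, x i ∈ Set.Ioo (0:ℝ) 1} → N'.IsRational → N.value = N'.value → Equivalent N N' :=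
  fun m' N N' _ => h 3 m' N N'

/-- **`KontsevichZagierPeriods ⇒ V2243`**: the variant is a special case of Conjecture 1 for the tree's
calculus — a refutation of the variant would refute the Summit. [cite: KontsevichZagier2001, §1.2 Conjecture 1] -/
theorem stub_boxRigidity_var2243_of_statement (h : _root_.KontsevichZagierPeriods) :
    ∀ (m' : ℕ) (N : IntegralRep 3) (N' : IntegralRep m'), m' ≤ 3 → N.domain = {x | ∀ i, x i ∈ Set.Ioo (0:ℝ) 1} → N.IsRational → N'.domain = {x | ∀ i, x i ∈ Set.Ioo (0:ℝ) 1} → N'.IsRational → N.value = N'.value → Equivalent N N' :=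
  stub_boxRigidity_var2243_of_parent (leaves_of_statement h).1

end Summit.KontsevichZagierPeriods.KontsevichZagierPeriods.Theorems
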